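import Mathlib
import Literature.Computability.AlgebraicComplexity.MatrixMultiplicationExponent
import Literature.Computability.AlgebraicComplexity.FlatteningBound
import Literature.Computability.AlgebraicComplexity.KroneckerRank

/-!
# MatrixMultiplication / ShapeSubmodularity — `ShapeSubmodular`, the unit cell from a modular sandwich

Route `ShapeSubmodularity`, crux `ShapeSubmodular` (stmt-MatrixMultiplication-15622), line
`registered` (RESHAPE 5), stub `stub_cellOfSandwich`.

Write `R(x,y,z)` for `n ↦ R⟨n^x, n^y, n^z⟩ = tensorRank (matMulTensor ℂ (n^x) (n^y) (n^z))` and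
`L(x,y,z) = max(x+y, y+z, x+z)` for the flattening value of the format `(x,y,z)`.  For the unit cell
`{a, a+1} × {b, b+1} × {c}` with meet `M = (a,b,c)`, hypothesis formats `P = (a+1,b,c)`,
`Q = (a,b+1,c)` and join `J = (a+1,b+1,c)`, the *modular sandwich* hypothesis hands us admissible
exponents `u` for `R(J)` and `u'` for `R(M)` with `u + u' ≤ L(P) + L(Q)`.  Then the unit-square
exchange law holds at the cell: admissible `β` for `R(P)` and `β'` for `R(Q)` give, for every
`ε > 0`, admissible `γ` for `R(J)` and `γ'` for `R(M)` with `γ + γ' ≤ β + β' + ε`.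

Proof.  Take `γ = u`, `γ' = u'`.  The flattening lower bounds
(`max_mul_le_tensorRank_matMulTensor`: `max(km, mn, kn) ≤ R⟨k,m,n⟩` for `k, m, n ≥ 1`) give
`n^{L(P)} ≤ R(P) n` and `n^{L(Q)} ≤ R(Q) n` for `n ≥ 1`, hence `L(P) ≤ β` and `L(Q) ≤ β'`
(a polynomial lower bound forces the exponent of any `O(n^β)` bound), and
`u + u' ≤ L(P) + L(Q) ≤ β + β' < β + β' + ε`.
-/

-- (single-conjunct summit: the namespace repeats MatrixMultiplication)
set_option linter.dupNamespace false

open Filter Asymptotics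
open Literature.Computability.AlgebraicComplexity

namespace Summit.MatrixMultiplication.MatrixMultiplication.Theorems.ShapeSubmodular

/-! ## `O`-bookkeeping and flattening -/

/-- A polynomial lower bound forces the exponent: if `n^k ≤ R n` for `n ≥ 1` and `R = O(n^β)`, then
`k ≤ β` (otherwise `n^{k-β} → ∞` would be bounded). [folklore] -/
private theorem sandwich_le_of_isBigO (R : ℕ → ℕ) (k : ℕ) (β : ℝ)
    (h : ∀ n : ℕ, 0 < n → n ^ k ≤ R n)
    (hO : (fun n : ℕ => (R n : ℝ)) =O[atTop] (fun n : ℕ => (n : ℝ) ^ β)) :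
    (k : ℝ) ≤ β := by
  -- adapted from `Theorems.ShapeSubmodular.cell_le_of_isBigO` (stub_cellOfFlatMeet)
  by_contra hlt
  rw [not_le] at hlt
  obtain ⟨C, hC⟩ := isBigO_iff.1 hO
  have hev : ∀ᶠ n : ℕ in atTop, (n : ℝ) ^ ((k : ℝ) - β) ≤ C := by
    filter_upwards [hC, eventually_gt_atTop 0] with n hn hn0
    have hn0' : (0 : ℝ) < n := Nat.cast_pos.2 hn0
    rw [Real.norm_of_nonneg (Nat.cast_nonneg _),
      Real.norm_of_nonneg (Real.rpow_nonneg (Nat.cast_nonneg _) _)] at hn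
    have hsq : (n : ℝ) ^ (k : ℝ) ≤ C * (n : ℝ) ^ β := by
      refine le_trans ?_ hn
      rw [Real.rpow_natCast]
      exact_mod_cast h n hn0
    rw [Real.rpow_sub hn0', div_le_iff₀ (Real.rpow_pos_of_pos hn0' _)]
    exact hsq
  have hlim : Tendsto (fun n : ℕ => (n : ℝ) ^ ((k : ℝ) - β)) atTop atTop :=
    (tendsto_rpow_atTop (by linarith)).comp tendsto_natCast_atTop_atTop
  obtain ⟨n, hn₁, hn₂⟩ := (hev.and (hlim.eventually_gt_atTop C)).exists
  exact absurd hn₁ (not_le.2 hn₂)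

/-- The flattening lower bound in exponent form: for `n ≥ 1`,
`n^{max(k+m, m+l, k+l)} ≤ R⟨n^k, n^m, n^l⟩`, from `max(KM, ML, KL) ≤ R⟨K, M, L⟩` for
`K, M, L ≥ 1` (Bläser 2013, Lemma 7.1 (2) with Lemma 5.5). [folklore] -/
private theorem sandwich_pow_max_le (n : ℕ) (hn : 0 < n) (k m l : ℕ) :
    n ^ (max (k + m) (max (m + l) (k + l))) ≤
      tensorRank (matMulTensor ℂ (n ^ k) (n ^ m) (n ^ l)) := by
  haveI : NeZero (n ^ k) := ⟨(pow_pos hn k).ne'⟩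
  haveI : NeZero (n ^ m) := ⟨(pow_pos hn m).ne'⟩
  haveI : NeZero (n ^ l) := ⟨(pow_pos hn l).ne'⟩
  have h := max_mul_le_tensorRank_matMulTensor ℂ (n ^ k) (n ^ m) (n ^ l)
  rw [← pow_add, ← pow_add, ← pow_add] at h
  refine le_trans ?_ h
  rcases max_choice (k + m) (max (m + l) (k + l)) with h₁ | h₁ <;> rw [h₁]
  · exact le_max_left _ _
  · rcases max_choice (m + l) (k + l) with h₂ | h₂ <;> rw [h₂]
    · exact le_max_of_le_right (le_max_left _ _)
    · exact le_max_of_le_right (le_max_right _ _)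

/-! ## The stub -/

/-- **The unit cell from a modular sandwich** (stub `stub_cellOfSandwich` of the line `registered`
of crux `ShapeSubmodular`): if the join `(a+1,b+1,c)` and the meet `(a,b,c)` of the unit cell admit
exponents `u`, `u'` with `u + u' ≤ L(a+1,b,c) + L(a,b+1,c)` (`L(x,y,z) = max(x+y, y+z, x+z)` the
flattening value), then admissible `β` for `R⟨n^(a+1), n^b, n^c⟩` and `β'` for
`R⟨n^a, n^(b+1), n^c⟩` give, for every `ε > 0`, admissible `γ` for `R⟨n^(a+1), n^(b+1), n^c⟩` and
`γ'` for `R⟨n^a, n^b, n^c⟩` with `γ + γ' ≤ β + β' + ε`: take `γ = u`, `γ' = u'` and use the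
flattening lower bounds `L(a+1,b,c) ≤ β`, `L(a,b+1,c) ≤ β'`
(`max_mul_le_tensorRank_matMulTensor`). [folklore] -/
theorem stub_cellOfSandwich :
    ∀ a b c : ℕ,
      (∃ u u' : ℝ,
        u + u' ≤ ((max (a + 1 + b) (max (b + c) (a + 1 + c)) + max (a + (b + 1)) (max (b + 1 + c) (a + c)) : ℕ) : ℝ) ∧
        (fun n : ℕ => (Literature.Computability.AlgebraicComplexity.tensorRank
          (Literature.Computability.AlgebraicComplexity.matMulTensor ℂ
            (n ^ (a + 1)) (n ^ (b + 1)) (n ^ c)) : ℝ))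
            =O[Filter.atTop] (fun n : ℕ => (n : ℝ) ^ u) ∧
        (fun n : ℕ => (Literature.Computability.AlgebraicComplexity.tensorRank
          (Literature.Computability.AlgebraicComplexity.matMulTensor ℂ (n ^ a) (n ^ b) (n ^ c)) : ℝ))
            =O[Filter.atTop] (fun n : ℕ => (n : ℝ) ^ u')) →
      ∀ β β' : ℝ,
      (fun n : ℕ => (Literature.Computability.AlgebraicComplexity.tensorRank
        (Literature.Computability.AlgebraicComplexity.matMulTensor ℂ (n ^ (a + 1)) (n ^ b) (n ^ c)) : ℝ))
          =O[Filter.atTop] (fun n : ℕ => (n : ℝ) ^ β) →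
      (fun n : ℕ => (Literature.Computability.AlgebraicComplexity.tensorRank
        (Literature.Computability.AlgebraicComplexity.matMulTensor ℂ (n ^ a) (n ^ (b + 1)) (n ^ c)) : ℝ))
          =O[Filter.atTop] (fun n : ℕ => (n : ℝ) ^ β') →
      ∀ ε : ℝ, 0 < ε → ∃ γ γ' : ℝ, γ + γ' ≤ β + β' + ε ∧
        (fun n : ℕ => (Literature.Computability.AlgebraicComplexity.tensorRank
          (Literature.Computability.AlgebraicComplexity.matMulTensor ℂ
            (n ^ (a + 1)) (n ^ (b + 1)) (n ^ c)) : ℝ))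
            =O[Filter.atTop] (fun n : ℕ => (n : ℝ) ^ γ) ∧
        (fun n : ℕ => (Literature.Computability.AlgebraicComplexity.tensorRank
          (Literature.Computability.AlgebraicComplexity.matMulTensor ℂ (n ^ a) (n ^ b) (n ^ c)) : ℝ))
            =O[Filter.atTop] (fun n : ℕ => (n : ℝ) ^ γ') := by
  intro a b c hS β β' h₁ h₂ ε hε
  obtain ⟨u, u', huu', hu, hu'⟩ := hS
  -- flattening on the two hypothesis formats
  have hβ : ((max (a + 1 + b) (max (b + c) (a + 1 + c)) : ℕ) : ℝ) ≤ β :=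
    sandwich_le_of_isBigO (fun n => tensorRank (matMulTensor ℂ (n ^ (a + 1)) (n ^ b) (n ^ c)))
      _ β (fun n hn => sandwich_pow_max_le n hn (a + 1) b c) h₁
  have hβ' : ((max (a + (b + 1)) (max (b + 1 + c) (a + c)) : ℕ) : ℝ) ≤ β' :=
    sandwich_le_of_isBigO (fun n => tensorRank (matMulTensor ℂ (n ^ a) (n ^ (b + 1)) (n ^ c)))
      _ β' (fun n hn => sandwich_pow_max_le n hn a (b + 1) c) h₂
  refine ⟨u, u', ?_, hu, hu'⟩
  rw [Nat.cast_add] at huu'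
  linarith
end Summit.MatrixMultiplication.MatrixMultiplication.Theorems.ShapeSubmodular
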